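import Summits.AnomalousDissipation.AnomalousDissipation.Theorems.TaylorWaveQuasiSteady.Negative.Stretching

/-!
# `NeutralTaylorWaves.TaylorWaveQuasiSteady` (stmt-AnomalousDissipation-16293): calculus of the horizontal part `w − w_a e_a`

Support lemmas (crux disprover, 2026-08-17) for `Negative/TwoHalfD.lean` (axis-invariant witnesses of the
crux are horizontally quiet): the torus calculus of a field minus a scalar function times a constant vector,
`W − Θ • e` (`Cⁿ`-ness, Fréchet and partial derivatives, Laplacian, coordinates of the Laplacian), and of the
HORIZONTAL PART `w_h := w − w_a e_a` of a smooth field `w` that is invariant along the axis `a`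
(`∂_a w ≡ 0`): `w_h` is planar w.r.t. `a` (`(w_h)_a ≡ 0`, `∂_a w_h ≡ 0`), divergence free when `w` is,
`Δw_h = Δw − (Δw_a)e_a` has no axial component, `(w_h·∇)w_h = (w·∇)w − (Dw_a[w_h]) e_a`, and
`‖w_h‖ ≤ ‖w‖` pointwise. Everything is Mathlib's `HasFDerivAt` calculus on the re-centred lifts plus the
tree's `Torus.laplacian_eq_sum_partialDeriv_partialDeriv`, `Torus.partialDeriv_apply_coord`,
`Torus.divergence_eq_sum_partialDeriv_apply`.
-/

-- `Summit.<Summit>.<Problem>` is the tree's mandated summit-side namespace (CONVENTIONS §2); for this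
-- single-conjunct summit the two coincide, so the duplicate is deliberate.
set_option linter.dupNamespace false

noncomputable section

open MeasureTheory Filter Topology
open scoped InnerProductSpace

namespace Summit.AnomalousDissipation.AnomalousDissipation.Theorems.TaylorWaveQuasiSteady.Negative

open Literature.Analysis.FunctionSpaces

variable {d : Type*} [Fintype d] [DecidableEq d]

/-! ## Calculus of `W − Θ • e` (a field minus a scalar function times a constant vector) -/

section SubSmulConst

variable {W : UnitAddTorus d → EuclideanSpace ℝ d} {Θ : UnitAddTorus d → ℝ}

omit [DecidableEq d] in
/-- `W − Θ • e` is `Cⁿ` for `Cⁿ` `W`, `Θ` and a constant vector `e`. [folklore] -/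
theorem isContDiff_sub_smul_const {n : WithTop ℕ∞} (hW : Torus.IsContDiff n W)
    (hΘ : Torus.IsContDiff n Θ) (e : EuclideanSpace ℝ d) :
    Torus.IsContDiff n (fun y => W y - Θ y • e) := by
  change ContDiff ℝ n (fun z => W (Torus.proj z) - Θ (Torus.proj z) • e)
  exact ContDiff.sub hW (ContDiff.smul hΘ contDiff_const)

omit [DecidableEq d] in
/-- `W − Θ • e` is smooth for smooth `W`, `Θ`. [folklore] -/
theorem isSmooth_sub_smul_const (hW : Torus.IsSmooth W) (hΘ : Torus.IsSmooth Θ)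
    (e : EuclideanSpace ℝ d) : Torus.IsSmooth (fun y => W y - Θ y • e) :=
  isContDiff_sub_smul_const hW hΘ e

omit [DecidableEq d] in
/-- Torus derivative of `W − Θ • e`: `D(W − Θe)(x)v = DW(x)v − (DΘ(x)v) e`. [folklore] -/
theorem fderiv_sub_smul_const (hW : Torus.IsContDiff 1 W) (hΘ : Torus.IsContDiff 1 Θ)
    (e : EuclideanSpace ℝ d) (x : UnitAddTorus d) (v : EuclideanSpace ℝ d) :
    Torus.fderiv (fun y => W y - Θ y • e) x v = Torus.fderiv W x v - (Torus.fderiv Θ x v) • e := by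
  have h1 : HasFDerivAt (Torus.liftAt W x) (_root_.fderiv ℝ (Torus.liftAt W x) 0) 0 :=
    ((hW.liftAt x).differentiable one_ne_zero).differentiableAt.hasFDerivAt
  have h2 : HasFDerivAt (Torus.liftAt Θ x) (_root_.fderiv ℝ (Torus.liftAt Θ x) 0) 0 :=
    ((hΘ.liftAt x).differentiable one_ne_zero).differentiableAt.hasFDerivAt
  have h3 : HasFDerivAt (Torus.liftAt (fun y => W y - Θ y • e) x)
      (_root_.fderiv ℝ (Torus.liftAt W x) 0 - (_root_.fderiv ℝ (Torus.liftAt Θ x) 0).smulRight e) 0 :=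
    h1.sub (h2.smul_const e)
  simp only [Torus.fderiv]
  rw [h3.fderiv]
  simp [ContinuousLinearMap.smulRight_apply]

/-- Partial derivatives of `W − Θ • e`: `∂ᵢ(W − Θe) = ∂ᵢW − (∂ᵢΘ) e`. [folklore] -/
theorem partialDeriv_sub_smul_const (hW : Torus.IsContDiff 1 W) (hΘ : Torus.IsContDiff 1 Θ)
    (e : EuclideanSpace ℝ d) (i : d) (x : UnitAddTorus d) :
    Torus.partialDeriv i (fun y => W y - Θ y • e) x =
      Torus.partialDeriv i W x - (Torus.partialDeriv i Θ x) • e := by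
  rw [Torus.partialDeriv_eq_fderiv_apply (isContDiff_sub_smul_const hW hΘ e),
    Torus.partialDeriv_eq_fderiv_apply hW, Torus.partialDeriv_eq_fderiv_apply hΘ,
    fderiv_sub_smul_const hW hΘ]

/-- Laplacian of `W − Θ • e`: `Δ(W − Θe) = ΔW − (ΔΘ) e`. [folklore] -/
theorem laplacian_sub_smul_const (hW : Torus.IsSmooth W) (hΘ : Torus.IsSmooth Θ)
    (e : EuclideanSpace ℝ d) (x : UnitAddTorus d) :
    Torus.laplacian (fun y => W y - Θ y • e) x =
      Torus.laplacian W x - (Torus.laplacian Θ x) • e := by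
  have hW1 : Torus.IsContDiff 1 W := hW.isContDiff (by simp)
  have hΘ1 : Torus.IsContDiff 1 Θ := hΘ.isContDiff (by simp)
  rw [Torus.laplacian_eq_sum_partialDeriv_partialDeriv (isSmooth_sub_smul_const hW hΘ e),
    Torus.laplacian_eq_sum_partialDeriv_partialDeriv hW,
    Torus.laplacian_eq_sum_partialDeriv_partialDeriv hΘ, Finset.sum_smul, ← Finset.sum_sub_distrib]
  refine Finset.sum_congr rfl fun i _ => ?_
  have h1 : Torus.partialDeriv i (fun y => W y - Θ y • e) =
      fun y => Torus.partialDeriv i W y - Torus.partialDeriv i Θ y • e :=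
    funext fun y => partialDeriv_sub_smul_const hW1 hΘ1 e i y
  rw [h1]
  exact partialDeriv_sub_smul_const ((hW.partialDeriv i).isContDiff (by simp))
    ((hΘ.partialDeriv i).isContDiff (by simp)) e i x

/-- Coordinates commute with the Laplacian: `(ΔW)ⱼ = Δ(Wⱼ)` for smooth `W`. [folklore] -/
theorem laplacian_apply_coord (hW : Torus.IsSmooth W) (x : UnitAddTorus d) (j : d) :
    Torus.laplacian W x j = Torus.laplacian (fun y => W y j) x := by
  have hW1 : Torus.IsContDiff 1 W := hW.isContDiff (by simp)
  have hproj : ∀ v : EuclideanSpace ℝ d, v j = EuclideanSpace.proj j v := fun v => rfl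
  rw [Torus.laplacian_eq_sum_partialDeriv_partialDeriv hW,
    Torus.laplacian_eq_sum_partialDeriv_partialDeriv (hW.apply j), hproj, map_sum]
  refine Finset.sum_congr rfl fun i _ => ?_
  rw [← hproj, ← Torus.partialDeriv_apply_coord ((hW.partialDeriv i).isContDiff (by simp))]
  have h : (fun y => Torus.partialDeriv i W y j) = Torus.partialDeriv i (fun y => W y j) :=
    funext fun y => (Torus.partialDeriv_apply_coord hW1 i y j).symm
  rw [h]

omit [Fintype d] in
/-- Partial derivatives of a constant vanish. [folklore] -/
theorem partialDeriv_const' {F : Type*} [NormedAddCommGroup F] [NormedSpace ℝ F] (c : F) (i : d)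
    (x : UnitAddTorus d) : Torus.partialDeriv i (fun _ : UnitAddTorus d => c) x = 0 := by
  simp [Torus.partialDeriv, Torus.lineDeriv]

/-- The Laplacian of a constant vanishes. [folklore] -/
theorem laplacian_const' {F : Type*} [NormedAddCommGroup F] [NormedSpace ℝ F] (c : F)
    (x : UnitAddTorus d) : Torus.laplacian (fun _ : UnitAddTorus d => c) x = 0 := by
  rw [Torus.laplacian_eq_sum_partialDeriv_partialDeriv (Torus.isSmooth_const c)]
  refine Finset.sum_eq_zero fun i _ => ?_
  have h : Torus.partialDeriv i (fun _ : UnitAddTorus d => c) = fun _ => (0 : F) :=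
    funext fun y => partialDeriv_const' c i y
  rw [h]
  exact partialDeriv_const' (0 : F) i x

end SubSmulConst

/-! ## The horizontal part of an axis-invariant field -/

section Horizontal

variable {w : UnitAddTorus d → EuclideanSpace ℝ d} {a : d}

omit [Fintype d] in
/-- The horizontal part `w − w_a e_a` has no axial component. [folklore] -/
theorem horizontal_apply_axis (w : UnitAddTorus d → EuclideanSpace ℝ d) (a : d) (x : UnitAddTorus d) :
    (w x - (w x a) • EuclideanSpace.single a (1 : ℝ)) a = 0 := by
  simp

/-- `⟪e_a, v⟫ = v_a`. [folklore] -/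
theorem inner_single_one_left (a : d) (v : EuclideanSpace ℝ d) :
    ⟪EuclideanSpace.single a (1 : ℝ), v⟫_ℝ = v a := by
  rw [EuclideanSpace.inner_single_left]
  simp

/-- Partial derivatives of the horizontal part: `∂ᵢ(w − w_a e_a) = ∂ᵢw − (∂ᵢw)_a e_a`. [folklore] -/
theorem partialDeriv_horizontal (hw : Torus.IsSmooth w) (a i : d) (x : UnitAddTorus d) :
    Torus.partialDeriv i (fun y => w y - (w y a) • EuclideanSpace.single a (1 : ℝ)) x =
      Torus.partialDeriv i w x - (Torus.partialDeriv i w x a) • EuclideanSpace.single a (1 : ℝ) := by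
  have hw1 : Torus.IsContDiff 1 w := hw.isContDiff (by simp)
  have hθ1 : Torus.IsContDiff 1 (fun y => w y a) := (hw.apply a).isContDiff (by simp)
  rw [partialDeriv_sub_smul_const hw1 hθ1, Torus.partialDeriv_apply_coord hw1]

/-- The horizontal part of an `a`-invariant field is `a`-invariant. [folklore] -/
theorem partialDeriv_horizontal_axis (hw : Torus.IsSmooth w) (hinv : ∀ x, Torus.partialDeriv a w x = 0)
    (x : UnitAddTorus d) :
    Torus.partialDeriv a (fun y => w y - (w y a) • EuclideanSpace.single a (1 : ℝ)) x = 0 := by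
  rw [partialDeriv_horizontal hw a a x, hinv x]
  simp

/-- The horizontal part of a divergence-free `a`-invariant field is divergence free
(`div w_h = div w − ∂_a w_a`). [folklore] -/
theorem isDivFree_horizontal (hw : Torus.IsSmooth w) (hdiv : Torus.IsDivFree w)
    (hinv : ∀ x, Torus.partialDeriv a w x = 0) :
    Torus.IsDivFree (fun y => w y - (w y a) • EuclideanSpace.single a (1 : ℝ)) := by
  intro x
  have hw1 : Torus.IsContDiff 1 w := hw.isContDiff (by simp)
  have hwh1 : Torus.IsContDiff 1 (fun y => w y - (w y a) • EuclideanSpace.single a (1 : ℝ)) :=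
    isContDiff_sub_smul_const hw1 ((hw.apply a).isContDiff (by simp)) _
  have h0 := hdiv x
  rw [Torus.divergence_eq_sum_partialDeriv_apply hw1] at h0
  rw [Torus.divergence_eq_sum_partialDeriv_apply hwh1]
  simp_rw [partialDeriv_horizontal hw a _ x]
  have hterm : ∀ i, (Torus.partialDeriv i w x - (Torus.partialDeriv i w x a) •
      EuclideanSpace.single a (1 : ℝ)) i =
      Torus.partialDeriv i w x i - Torus.partialDeriv i w x a * (if i = a then 1 else 0) := by
    intro i
    simp
  simp_rw [hterm]
  rw [Finset.sum_sub_distrib, h0]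
  have hsum : ∑ i, Torus.partialDeriv i w x a * (if i = a then (1 : ℝ) else 0) =
      Torus.partialDeriv a w x a := by
    simp [Finset.sum_ite_eq']
  rw [hsum, hinv x]
  simp

/-- Laplacian of the horizontal part: `Δ(w − w_a e_a) = Δw − (Δw_a) e_a`. [folklore] -/
theorem laplacian_horizontal (hw : Torus.IsSmooth w) (a : d) (x : UnitAddTorus d) :
    Torus.laplacian (fun y => w y - (w y a) • EuclideanSpace.single a (1 : ℝ)) x =
      Torus.laplacian w x - (Torus.laplacian (fun y => w y a) x) • EuclideanSpace.single a (1 : ℝ) :=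
  laplacian_sub_smul_const hw (hw.apply a) _ x

/-- The Laplacian of the horizontal part has no axial component. [folklore] -/
theorem laplacian_horizontal_apply_axis (hw : Torus.IsSmooth w) (a : d) (x : UnitAddTorus d) :
    Torus.laplacian (fun y => w y - (w y a) • EuclideanSpace.single a (1 : ℝ)) x a = 0 := by
  have hwh : Torus.IsSmooth (fun y => w y - (w y a) • EuclideanSpace.single a (1 : ℝ)) :=
    isSmooth_sub_smul_const hw (hw.apply a) _
  rw [laplacian_apply_coord hwh x a]
  have h : (fun y => (w y - (w y a) • EuclideanSpace.single a (1 : ℝ)) a) = fun _ => (0 : ℝ) :=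
    funext fun y => horizontal_apply_axis w a y
  rw [h]
  exact laplacian_const' (0 : ℝ) x

/-- Convective term of the horizontal part of an `a`-invariant field:
`(w_h·∇)w_h = (w·∇)w − (Dw_a[w_h]) e_a` (uses `∂_a w = 0`). [folklore] -/
theorem convect_horizontal (hw : Torus.IsSmooth w) (hinv : ∀ x, Torus.partialDeriv a w x = 0)
    (x : UnitAddTorus d) :
    Torus.convect (fun y => w y - (w y a) • EuclideanSpace.single a (1 : ℝ))
        (fun y => w y - (w y a) • EuclideanSpace.single a (1 : ℝ)) x =
      Torus.convect w w x -
        (Torus.fderiv (fun y => w y a) x (w x - (w x a) • EuclideanSpace.single a (1 : ℝ))) •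
          EuclideanSpace.single a (1 : ℝ) := by
  have hw1 : Torus.IsContDiff 1 w := hw.isContDiff (by simp)
  have hθ1 : Torus.IsContDiff 1 (fun y => w y a) := (hw.apply a).isContDiff (by simp)
  simp only [Torus.convect]
  rw [fderiv_sub_smul_const hw1 hθ1]
  congr 1
  rw [map_sub, map_smul, ← Torus.partialDeriv_eq_fderiv_apply hw1 a x, hinv x, smul_zero, sub_zero]

/-- Pointwise: `‖w_h‖² ≤ ‖w‖²`. [folklore] -/
theorem norm_sq_horizontal_le (w : UnitAddTorus d → EuclideanSpace ℝ d) (a : d) (x : UnitAddTorus d) :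
    ‖w x - (w x a) • EuclideanSpace.single a (1 : ℝ)‖ ^ 2 ≤ ‖w x‖ ^ 2 := by
  set e : EuclideanSpace ℝ d := EuclideanSpace.single a (1 : ℝ)
  have hx : w x = (w x - (w x a) • e) + (w x a) • e := by abel
  have horth : ⟪w x - (w x a) • e, (w x a) • e⟫_ℝ = 0 := by
    rw [real_inner_smul_right, real_inner_comm, inner_single_one_left]
    simp [e]
  have h := norm_add_sq_real (w x - (w x a) • e) ((w x a) • e)
  rw [← hx, horth] at h
  nlinarith [sq_nonneg ‖(w x a) • e‖]

end Horizontal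

end Summit.AnomalousDissipation.AnomalousDissipation.Theorems.TaylorWaveQuasiSteady.Negative

end
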